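import Mathlib
import Summits.Ventures.PercRepro2.UniversalTransport
import Summits.Ventures.PercRepro2.UniversalSeriesBundlesSP

/-! # (UH*) does not depend on the bracketing or the order of a series–parallel network
(seat mine-b, cell pub-perc-repro2; MINE-B.md §26.7)

The kernel census files prove `Universal` for ONE term per network (enum8's normal form).  Here
`SP.Equiv` is the congruence on terms generated by the commutativity and associativity of `ser` and
`par`; equivalent terms have label-preserving order-isomorphic configuration cubes
(`SP.Equiv.exists_iso`: `OrderIso.prodComm`, `OrderIso.prodAssoc`, `prodIso`), so (UH*) transports
along `universal_transport` (`SP.universal_of_equiv`): every bracketing and ordering of a network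
with a (UH*) term has (UH*). -/

namespace Summit.Ventures.PercRepro2.V2Closure

open Summit.Ventures.PercRepro2.UHClosure

/-- the congruence on SP terms generated by commutativity and associativity of `ser` and `par` -/
inductive SP.Equiv : SP → SP → Prop
  | refl (s : SP) : SP.Equiv s s
  | symm {s t : SP} : SP.Equiv s t → SP.Equiv t s
  | trans {s t u : SP} : SP.Equiv s t → SP.Equiv t u → SP.Equiv s u
  | ser_comm (s t : SP) : SP.Equiv (.ser s t) (.ser t s)
  | par_comm (s t : SP) : SP.Equiv (.par s t) (.par t s)
  | ser_assoc (s t u : SP) : SP.Equiv (.ser (.ser s t) u) (.ser s (.ser t u))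
  | par_assoc (s t u : SP) : SP.Equiv (.par (.par s t) u) (.par s (.par t u))
  | ser_congr {s s' t t' : SP} : SP.Equiv s s' → SP.Equiv t t' → SP.Equiv (.ser s t) (.ser s' t')
  | par_congr {s s' t t' : SP} : SP.Equiv s s' → SP.Equiv t t' → SP.Equiv (.par s t) (.par s' t')

/-- **equivalent terms have label-preserving order-isomorphic cubes** -/
theorem SP.Equiv.exists_iso {s t : SP} (h : SP.Equiv s t) :
    ∃ e : s.Conf ≃o t.Conf, (∀ c, t.rLab (e c) = s.rLab c) ∧ (∀ c, t.bLab (e c) = s.bLab c) := by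
  induction h with
  | refl s => exact ⟨OrderIso.refl _, fun _ => rfl, fun _ => rfl⟩
  | symm _ ih =>
    obtain ⟨e, hr, hb⟩ := ih
    refine ⟨e.symm, fun d => ?_, fun d => ?_⟩
    · rw [← hr (e.symm d), e.apply_symm_apply]
    · rw [← hb (e.symm d), e.apply_symm_apply]
  | trans _ _ ih₁ ih₂ =>
    obtain ⟨e₁, hr₁, hb₁⟩ := ih₁
    obtain ⟨e₂, hr₂, hb₂⟩ := ih₂
    exact ⟨e₁.trans e₂, fun c => by rw [OrderIso.trans_apply, hr₂, hr₁],
      fun c => by rw [OrderIso.trans_apply, hb₂, hb₁]⟩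
  | ser_comm s t =>
    refine ⟨(OrderIso.prodComm : s.Conf × t.Conf ≃o t.Conf × s.Conf), fun c => ?_, fun c => ?_⟩
    · show min (t.rLab c.2) (s.rLab c.1) = min (s.rLab c.1) (t.rLab c.2)
      exact min_comm _ _
    · show min (t.bLab c.2) (s.bLab c.1) = min (s.bLab c.1) (t.bLab c.2)
      exact min_comm _ _
  | par_comm s t =>
    refine ⟨(OrderIso.prodComm : s.Conf × t.Conf ≃o t.Conf × s.Conf), fun c => ?_, fun c => ?_⟩
    · show t.rLab c.2 + s.rLab c.1 = s.rLab c.1 + t.rLab c.2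
      exact add_comm _ _
    · show t.bLab c.2 + s.bLab c.1 = s.bLab c.1 + t.bLab c.2
      exact add_comm _ _
  | ser_assoc s t u =>
    refine ⟨OrderIso.prodAssoc s.Conf t.Conf u.Conf, fun c => ?_, fun c => ?_⟩
    · show min (s.rLab c.1.1) (min (t.rLab c.1.2) (u.rLab c.2)) =
        min (min (s.rLab c.1.1) (t.rLab c.1.2)) (u.rLab c.2)
      exact (min_assoc _ _ _).symm
    · show min (s.bLab c.1.1) (min (t.bLab c.1.2) (u.bLab c.2)) =
        min (min (s.bLab c.1.1) (t.bLab c.1.2)) (u.bLab c.2)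
      exact (min_assoc _ _ _).symm
  | par_assoc s t u =>
    refine ⟨OrderIso.prodAssoc s.Conf t.Conf u.Conf, fun c => ?_, fun c => ?_⟩
    · show s.rLab c.1.1 + (t.rLab c.1.2 + u.rLab c.2) = s.rLab c.1.1 + t.rLab c.1.2 + u.rLab c.2
      exact (add_assoc _ _ _).symm
    · show s.bLab c.1.1 + (t.bLab c.1.2 + u.bLab c.2) = s.bLab c.1.1 + t.bLab c.1.2 + u.bLab c.2
      exact (add_assoc _ _ _).symm
  | @ser_congr s s' t t' _ _ ih₁ ih₂ =>
    obtain ⟨e₁, hr₁, hb₁⟩ := ih₁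
    obtain ⟨e₂, hr₂, hb₂⟩ := ih₂
    refine ⟨prodIso e₁ e₂, fun c => ?_, fun c => ?_⟩
    · show min (s'.rLab (e₁ c.1)) (t'.rLab (e₂ c.2)) = min (s.rLab c.1) (t.rLab c.2)
      rw [hr₁, hr₂]
    · show min (s'.bLab (e₁ c.1)) (t'.bLab (e₂ c.2)) = min (s.bLab c.1) (t.bLab c.2)
      rw [hb₁, hb₂]
  | @par_congr s s' t t' _ _ ih₁ ih₂ =>
    obtain ⟨e₁, hr₁, hb₁⟩ := ih₁
    obtain ⟨e₂, hr₂, hb₂⟩ := ih₂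
    refine ⟨prodIso e₁ e₂, fun c => ?_, fun c => ?_⟩
    · show s'.rLab (e₁ c.1) + t'.rLab (e₂ c.2) = s.rLab c.1 + t.rLab c.2
      rw [hr₁, hr₂]
    · show s'.bLab (e₁ c.1) + t'.bLab (e₂ c.2) = s.bLab c.1 + t.bLab c.2
      rw [hb₁, hb₂]

/-- **(UH*) transports along `SP.Equiv`**: every bracketing and ordering of a network with a
(UH*) term has (UH*). -/
theorem SP.universal_of_equiv {s t : SP} (h : SP.Equiv s t) (hs : Universal s.rLab s.bLab) :
    Universal t.rLab t.bLab := by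
  obtain ⟨e, hr, hb⟩ := h.exists_iso
  have hr' : t.rLab = s.rLab ∘ e.symm := by
    funext d; rw [Function.comp_apply, ← hr (e.symm d), e.apply_symm_apply]
  have hb' : t.bLab = s.bLab ∘ e.symm := by
    funext d; rw [Function.comp_apply, ← hb (e.symm d), e.apply_symm_apply]
  rw [hr', hb']
  exact universal_transport e _ _ hs

/-- **(UH*) is an invariant of the equivalence class**: equivalent terms have it together. -/
theorem SP.universal_iff_of_equiv {s t : SP} (h : SP.Equiv s t) :
    Universal s.rLab s.bLab ↔ Universal t.rLab t.bLab :=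
  ⟨SP.universal_of_equiv h, SP.universal_of_equiv h.symm⟩

end Summit.Ventures.PercRepro2.V2Closure
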